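import Mathlib
import Summits.ValiantsHypothesis.ValiantsHypothesis.Theorems.RigidityForcesSymmetryRankRigidMinimalReprLaplaceFourDefs
import Summits.ValiantsHypothesis.ValiantsHypothesis.Theorems.RigidityForcesSymmetryRankRigidMinimalReprLaplaceFourContraction
import Summits.ValiantsHypothesis.ValiantsHypothesis.Theorems.RigidityForcesSymmetryRankRigidMinimalReprLaplaceFourLineCore
import Summits.ValiantsHypothesis.ValiantsHypothesis.Theorems.RigidityForcesSymmetryRankRigidMinimalReprLaplaceFourLinePsi
import Summits.ValiantsHypothesis.ValiantsHypothesis.Theorems.RigidityForcesSymmetryRankRigidMinimalReprLaplaceFourLineE3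

/-!
# The profile `(2,2,1)`: exclusion of the BLOCK type
# (crux `RankRigidMinimalRepr`, stmt-ValiantsHypothesis-18034, route `RigidityForcesSymmetry`)

For a decomposition `P₄ = Σ_{t<2} g_t(v₀,v₁)h_t(v₂,v₃) + Σ_{k<2} b_k(v₀,v₂)b′_k(v₁,v₃) + c(v₀,v₃)c′(v₁,v₂)`,
two rows `c₀ ≠ d₀` of both `g_t` cannot vanish (`block_false`).  WLOG (letter relabelling) `{c₀,d₀} = {0,1}`; then
`Q(e₁,φ) = Σ_k b_k(1,·)(B′_kφ)ᵀ + (C′φ)c(1,·)ᵀ` for all `φ`.  The `{0,2,3}`-block of `Q(e₁,φ)` is invertible for generic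
`φ`, so the three column vectors and the three row vectors are bases, and the vanishing row/column `1` of `Q(e₁,φ)` forces
`c′(·,1) = 0`, `b′_k(·,1) = 0` (`rank3_lemma`).  Then column `1` of `Q(e₀,φ)` gives `c′(0,·) = 0` and `c(0,1) ≠ 0`, and
the `{2,3}`-columns of the rows `1` of `Q(e₀,·)` and `2, 3` of `Q(e₁,·)` at `φ = e₀, e₂` are contradictory.

HONEST FRAMING: a step toward `LaplaceOptimal 4` (rung `TiedTorusBound 3`); the crux stays OPEN; nothing on `VP ≠ VNP`.
-/

set_option autoImplicit false

-- the mandated summit-side namespace repeats a component by design (single-problem summit)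
set_option linter.dupNamespace false

namespace Summit.ValiantsHypothesis.ValiantsHypothesis.Theorems.RigidityForcesSymmetryRankRigidMinimalRepr

namespace LaplaceFourLine

open Matrix LaplaceFourContraction

/-! ### §1 The contraction on the kernel of the noise -/

/-- For a `(2,2,1)` decomposition: if `ψ ⊥ g₀φ, g₁φ` then `Q(ψ,φ) = Σ_k (B_kψ)(B′_kφ)ᵀ + (C′φ)(Cψ)ᵀ`. -/
theorem contract_eq_rank_three (g h b b' : Fin 2 → Fin 4 → Fin 4 → ℂ) (c c' : Fin 4 → Fin 4 → ℂ)
    (hsum : ∀ v, permPattern₄ v = (∑ t, g t (v 0) (v 1) * h t (v 2) (v 3)) +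
      (∑ k, b k (v 0) (v 2) * b' k (v 1) (v 3)) + c (v 0) (v 3) * c' (v 1) (v 2))
    (ψ φ : Fin 4 → ℂ) (hψ : ∀ t, (∑ i, ∑ j, ψ i * φ j * g t i j) = 0) :
    contract₀₁ permPattern₄ ψ φ =
      vecMulVec (fun i => ∑ z, ψ z * b 0 z i) (fun j => ∑ w, φ w * b' 0 w j) +
        vecMulVec (fun i => ∑ z, ψ z * b 1 z i) (fun j => ∑ w, φ w * b' 1 w j) +
        vecMulVec (fun i => ∑ w, φ w * c' w i) (fun j => ∑ z, ψ z * c z j) := by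
  rw [contract_congr hsum]
  have hsplit : (fun v => (∑ t, g t (v 0) (v 1) * h t (v 2) (v 3)) + (∑ k, b k (v 0) (v 2) * b' k (v 1) (v 3)) +
      c (v 0) (v 3) * c' (v 1) (v 2)) = fun v => ∑ k : Fin 3, (![fun v => ∑ t, g t (v 0) (v 1) * h t (v 2) (v 3),
      fun v => ∑ k, b k (v 0) (v 2) * b' k (v 1) (v 3), fun v => c (v 0) (v 3) * c' (v 1) (v 2)] :
        Fin 3 → (Fin 4 → Fin 4) → ℂ) k v := by
    funext v; simp [Fin.sum_univ_three]
  rw [contract_congr (fun v => congrFun hsplit v), contract_sum, Fin.sum_univ_three]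
  simp only [Matrix.cons_val_zero, Matrix.cons_val_one, Matrix.cons_val_two, Matrix.tail_cons, Matrix.head_cons]
  rw [contract_sum Finset.univ (fun t v => g t (v 0) (v 1) * h t (v 2) (v 3)),
    contract_sum Finset.univ (fun k v => b k (v 0) (v 2) * b' k (v 1) (v 3)), contract_pair03]
  have hnoise : (∑ t, contract₀₁ (fun v => g t (v 0) (v 1) * h t (v 2) (v 3)) ψ φ) = 0 :=
    Finset.sum_eq_zero fun t _ => by rw [contract_pair01, hψ t, zero_smul]
  rw [hnoise, zero_add, Fin.sum_univ_two, contract_pair02, contract_pair02]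

/-- Relabelling the letters by `π` in a `(2,2,1)` decomposition gives a `(2,2,1)` decomposition. -/
theorem hsum221_letterPerm (g h b b' : Fin 2 → Fin 4 → Fin 4 → ℂ) (c c' : Fin 4 → Fin 4 → ℂ)
    (hsum : ∀ v, permPattern₄ v = (∑ t, g t (v 0) (v 1) * h t (v 2) (v 3)) +
      (∑ k, b k (v 0) (v 2) * b' k (v 1) (v 3)) + c (v 0) (v 3) * c' (v 1) (v 2)) (π : Equiv.Perm (Fin 4)) :
    ∀ v, permPattern₄ v = (∑ t, g t (π (v 0)) (π (v 1)) * h t (π (v 2)) (π (v 3))) +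
      (∑ k, b k (π (v 0)) (π (v 2)) * b' k (π (v 1)) (π (v 3))) + c (π (v 0)) (π (v 3)) * c' (π (v 1)) (π (v 2)) := by
  intro v
  have := congrFun (letterPerm_permPattern π) v
  rw [← this]
  exact hsum (π ∘ v)

/-! ### §2 The rank-three lemma -/

/-- **Rank-three lemma.**  If `Q(e₁,φ) = β₀ u₀ᵀ + β₁ u₁ᵀ + c′ γᵀ` entrywise with `φ₀φ₂φ₃ ≠ 0`, then the `1`-entries of
`c′, u₀, u₁` (and of `β₀, β₁, γ`) vanish: the `{0,2,3}`-block of `Q(e₁,φ)` is invertible. -/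
theorem rank3_lemma (φ β₀ β₁ cφ u₀ u₁ γ : Fin 4 → ℂ) (h0 : φ 0 ≠ 0) (h2 : φ 2 ≠ 0) (h3 : φ 3 ≠ 0)
    (H : ∀ i j : Fin 4, (!![0, 0, φ 3, φ 2; 0, 0, 0, 0; φ 3, 0, 0, φ 0; φ 2, 0, φ 0, 0] : Matrix (Fin 4) (Fin 4) ℂ) i j =
      β₀ i * u₀ j + β₁ i * u₁ j + cφ i * γ j) :
    cφ 1 = 0 ∧ u₀ 1 = 0 ∧ u₁ 1 = 0 := by
  have e : ∀ i j, β₀ i * u₀ j + β₁ i * u₁ j + cφ i * γ j =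
      (!![0, 0, φ 3, φ 2; 0, 0, 0, 0; φ 3, 0, 0, φ 0; φ 2, 0, φ 0, 0] : Matrix (Fin 4) (Fin 4) ℂ) i j :=
    fun i j => (H i j).symm
  have e10 : β₀ 1 * u₀ 0 + β₁ 1 * u₁ 0 + cφ 1 * γ 0 = 0 := by simpa using e 1 0
  have e12 : β₀ 1 * u₀ 2 + β₁ 1 * u₁ 2 + cφ 1 * γ 2 = 0 := by simpa using e 1 2
  have e13 : β₀ 1 * u₀ 3 + β₁ 1 * u₁ 3 + cφ 1 * γ 3 = 0 := by simpa using e 1 3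
  have e01 : β₀ 0 * u₀ 1 + β₁ 0 * u₁ 1 + cφ 0 * γ 1 = 0 := by simpa using e 0 1
  have e21 : β₀ 2 * u₀ 1 + β₁ 2 * u₁ 1 + cφ 2 * γ 1 = 0 := by simpa using e 2 1
  have e31 : β₀ 3 * u₀ 1 + β₁ 3 * u₁ 1 + cφ 3 * γ 1 = 0 := by simpa using e 3 1
  -- the two `3 × 3` factors on the indices `{0,2,3}`
  let M : Matrix (Fin 3) (Fin 3) ℂ := !![β₀ 0, β₁ 0, cφ 0; β₀ 2, β₁ 2, cφ 2; β₀ 3, β₁ 3, cφ 3]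
  let N : Matrix (Fin 3) (Fin 3) ℂ := !![u₀ 0, u₁ 0, γ 0; u₀ 2, u₁ 2, γ 2; u₀ 3, u₁ 3, γ 3]
  have hS : M * Nᵀ = !![0, φ 3, φ 2; φ 3, 0, φ 0; φ 2, φ 0, 0] := by
    ext i j
    fin_cases i <;> fin_cases j <;> simp [M, N, Matrix.mul_apply, Fin.sum_univ_three, e]
  have hdet : M.det * N.det = 2 * (φ 0 * φ 2 * φ 3) := by
    rw [← Matrix.det_transpose N, ← Matrix.det_mul, hS]
    simp [Matrix.det_fin_three]; ring
  have hπ : 2 * (φ 0 * φ 2 * φ 3) ≠ 0 := mul_ne_zero two_ne_zero (mul_ne_zero (mul_ne_zero h0 h2) h3)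
  have hM : M.det ≠ 0 := fun h => hπ (by rw [← hdet, h, zero_mul])
  have hN : N.det ≠ 0 := fun h => hπ (by rw [← hdet, h, mul_zero])
  -- row `1` of `Q(e₁,φ)` vanishes
  have hrow : N *ᵥ ![β₀ 1, β₁ 1, cφ 1] = 0 := by
    ext j
    fin_cases j <;> simp [N, Matrix.mulVec, dotProduct, Fin.sum_univ_three] <;>
      [linear_combination e10; linear_combination e12; linear_combination e13]
  -- column `1` of `Q(e₁,φ)` vanishes
  have hcol : M *ᵥ ![u₀ 1, u₁ 1, γ 1] = 0 := by
    ext i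
    fin_cases i <;> simp [M, Matrix.mulVec, dotProduct, Fin.sum_univ_three] <;>
      [linear_combination e01; linear_combination e21; linear_combination e31]
  have h1 := Matrix.eq_zero_of_mulVec_eq_zero hN hrow
  have h2' := Matrix.eq_zero_of_mulVec_eq_zero hM hcol
  have e1 := congrFun h1 2
  have e2 := congrFun h2' 0
  have e3 := congrFun h2' 1
  simp at e1 e2 e3
  exact ⟨e1, e2, e3⟩

/-! ### §3 The identities at `ψ = e₀, e₁` and the exclusion -/

/-- The contraction at `ψ = e₀`. -/
theorem contract_single_zero (φ : Fin 4 → ℂ) : contract₀₁ permPattern₄ (Pi.single 0 1) φ =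
    !![0, 0, 0, 0; 0, 0, φ 3, φ 2; 0, φ 3, 0, φ 1; 0, φ 2, φ 1, 0] := by
  rw [contract_permPattern_entries]; ext i j; fin_cases i <;> fin_cases j <;> simp

/-- The contraction at `ψ = e₁`. -/
theorem contract_single_one (φ : Fin 4 → ℂ) : contract₀₁ permPattern₄ (Pi.single 1 1) φ =
    !![0, 0, φ 3, φ 2; 0, 0, 0, 0; φ 3, 0, 0, φ 0; φ 2, 0, φ 0, 0] := by
  rw [contract_permPattern_entries]; ext i j; fin_cases i <;> fin_cases j <;> simp

/-- BLOCK at `{0,1}`, step 1: `c′(·,1) = 0` and `b′_k(·,1) = 0`. -/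
theorem block01_step1 (g h b b' : Fin 2 → Fin 4 → Fin 4 → ℂ) (c c' : Fin 4 → Fin 4 → ℂ)
    (hsum : ∀ v, permPattern₄ v = (∑ t, g t (v 0) (v 1) * h t (v 2) (v 3)) +
      (∑ k, b k (v 0) (v 2) * b' k (v 1) (v 3)) + c (v 0) (v 3) * c' (v 1) (v 2))
    (hrows : ∀ t j, g t 1 j = 0) : ∀ w, c' w 1 = 0 ∧ b' 0 w 1 = 0 ∧ b' 1 w 1 = 0 := by
  -- the identity at `ψ = e₁`
  have hI : ∀ (φ : Fin 4 → ℂ) (i j : Fin 4),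
      (!![0, 0, φ 3, φ 2; 0, 0, 0, 0; φ 3, 0, 0, φ 0; φ 2, 0, φ 0, 0] : Matrix (Fin 4) (Fin 4) ℂ) i j =
        b 0 1 i * (∑ w, φ w * b' 0 w j) + b 1 1 i * (∑ w, φ w * b' 1 w j) + (∑ w, φ w * c' w i) * c 1 j := by
    intro φ i j
    have h0 := contract_eq_rank_three g h b b' c c' hsum (Pi.single 1 1) φ (fun t => by
      simp [Pi.single_apply, Finset.sum_ite_eq', hrows t])
    rw [contract_single_one] at h0
    have := congrFun (congrFun h0 i) j
    simpa [vecMulVec_apply, Pi.single_apply, Finset.sum_ite_eq'] using this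
  -- at the four points `𝟙, 𝟙 + e₀, 𝟙 + e₂, 𝟙 + e₃`
  have step : ∀ φ : Fin 4 → ℂ, φ 0 ≠ 0 → φ 2 ≠ 0 → φ 3 ≠ 0 →
      (∑ w, φ w * c' w 1) = 0 ∧ (∑ w, φ w * b' 0 w 1) = 0 ∧ (∑ w, φ w * b' 1 w 1) = 0 := fun φ h0 h2 h3 =>
    rank3_lemma φ (fun i => b 0 1 i) (fun i => b 1 1 i) (fun i => ∑ w, φ w * c' w i)
      (fun j => ∑ w, φ w * b' 0 w j) (fun j => ∑ w, φ w * b' 1 w j) (fun j => c 1 j) h0 h2 h3 (hI φ)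
  have s0 := step 1 (by simp) (by simp) (by simp)
  simp only [Pi.one_apply, one_mul] at s0
  have key : ∀ m : Fin 4, m ≠ 1 → c' m 1 = 0 ∧ b' 0 m 1 = 0 ∧ b' 1 m 1 = 0 := by
    intro m hm
    have hne : ∀ i : Fin 4, (1 + Pi.single m (1 : ℂ) : Fin 4 → ℂ) i ≠ 0 := by
      intro i; rw [Pi.add_apply, Pi.one_apply, Pi.single_apply]; split_ifs <;> norm_num
    have := step (1 + Pi.single m 1) (hne 0) (hne 2) (hne 3)
    simp only [Pi.add_apply, Pi.one_apply, add_mul, one_mul, Finset.sum_add_distrib, Pi.single_apply, ite_mul,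
      zero_mul, Finset.sum_ite_eq', Finset.mem_univ, if_true, s0.1, s0.2.1, s0.2.2, zero_add] at this
    exact this
  intro w
  by_cases hw : w = 1
  · subst hw
    have k0 := key 0 (by decide); have k2 := key 2 (by decide); have k3 := key 3 (by decide)
    simp only [Fin.sum_univ_four] at s0
    exact ⟨by linear_combination s0.1 - k0.1 - k2.1 - k3.1, by linear_combination s0.2.1 - k0.2.1 - k2.2.1 - k3.2.1,
      by linear_combination s0.2.2 - k0.2.2 - k2.2.2 - k3.2.2⟩
  · exact key w hw

/-- **BLOCK at `{0,1}` is impossible.** -/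
theorem block01_false (g h b b' : Fin 2 → Fin 4 → Fin 4 → ℂ) (c c' : Fin 4 → Fin 4 → ℂ)
    (hsum : ∀ v, permPattern₄ v = (∑ t, g t (v 0) (v 1) * h t (v 2) (v 3)) +
      (∑ k, b k (v 0) (v 2) * b' k (v 1) (v 3)) + c (v 0) (v 3) * c' (v 1) (v 2))
    (hrows : ∀ t j, g t 0 j = 0 ∧ g t 1 j = 0) : False := by
  obtain F := block01_step1 g h b b' c c' hsum (fun t j => (hrows t j).2)
  -- the identities at `ψ = e₀` and `ψ = e₁`, at a point `φ = e_m`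
  have hIa : ∀ (m i j : Fin 4),
      (!![0, 0, 0, 0; 0, 0, (Pi.single m (1 : ℂ) : Fin 4 → ℂ) 3, (Pi.single m (1 : ℂ) : Fin 4 → ℂ) 2;
          0, (Pi.single m (1 : ℂ) : Fin 4 → ℂ) 3, 0, (Pi.single m (1 : ℂ) : Fin 4 → ℂ) 1;
          0, (Pi.single m (1 : ℂ) : Fin 4 → ℂ) 2, (Pi.single m (1 : ℂ) : Fin 4 → ℂ) 1, 0] :
          Matrix (Fin 4) (Fin 4) ℂ) i j =
        b 0 0 i * b' 0 m j + b 1 0 i * b' 1 m j + c' m i * c 0 j := by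
    intro m i j
    have h0 := contract_eq_rank_three g h b b' c c' hsum (Pi.single 0 1) (Pi.single m 1) (fun t => by
      simp [Pi.single_apply, Finset.sum_ite_eq', (hrows t _).1])
    rw [contract_single_zero] at h0
    have := congrFun (congrFun h0 i) j
    simpa [vecMulVec_apply, Pi.single_apply, Finset.sum_ite_eq'] using this
  have hIb : ∀ (m i j : Fin 4),
      (!![0, 0, (Pi.single m (1 : ℂ) : Fin 4 → ℂ) 3, (Pi.single m (1 : ℂ) : Fin 4 → ℂ) 2; 0, 0, 0, 0;
          (Pi.single m (1 : ℂ) : Fin 4 → ℂ) 3, 0, 0, (Pi.single m (1 : ℂ) : Fin 4 → ℂ) 0;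
          (Pi.single m (1 : ℂ) : Fin 4 → ℂ) 2, 0, (Pi.single m (1 : ℂ) : Fin 4 → ℂ) 0, 0] :
          Matrix (Fin 4) (Fin 4) ℂ) i j =
        b 0 1 i * b' 0 m j + b 1 1 i * b' 1 m j + c' m i * c 1 j := by
    intro m i j
    have h0 := contract_eq_rank_three g h b b' c c' hsum (Pi.single 1 1) (Pi.single m 1) (fun t => by
      simp [Pi.single_apply, Finset.sum_ite_eq', (hrows t _).2])
    rw [contract_single_one] at h0
    have := congrFun (congrFun h0 i) j
    simpa [vecMulVec_apply, Pi.single_apply, Finset.sum_ite_eq'] using this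
  -- step 3: `κ = c(0,1) ≠ 0` and `c′(0,·) = 0` (column `1` of the identity at `e₀`)
  have hκ : c 0 1 ≠ 0 := by
    have := hIa 3 2 1
    simp [(F 3).2.1, (F 3).2.2] at this
    intro h0; rw [h0, mul_zero] at this; exact one_ne_zero this
  have hc0 : ∀ i, c' 0 i = 0 := by
    intro i
    have := hIa 0 i 1
    rw [(F 0).2.1, (F 0).2.2] at this
    fin_cases i <;> simp at this <;> first | exact this.resolve_left hκ | exact this.resolve_right hκ
  -- step 4: the `{2,3}` columns at `φ = e₀, e₂`
  have r12 := hIa 0 1 2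
  have r13 := hIa 0 1 3
  have q13 := hIa 2 1 3
  have x2 := hIb 0 2 2
  have x3 := hIb 0 2 3
  have y2 := hIb 0 3 2
  have y3 := hIb 0 3 3
  simp [(F 0).1, (F 2).1, hc0] at r12 r13 q13 x2 x3 y2 y3
  -- `D = p₂q₃ - p₃q₂ ≠ 0` from the rows `2, 3` of `Q(e₁,e₀)`, and `λ = μ = 0` from row `1` of `Q(e₀,e₀)`
  have hD : (b 0 1 2 * b 1 1 3 - b 1 1 2 * b 0 1 3) * (b' 0 0 3 * b' 1 0 2 - b' 0 0 2 * b' 1 0 3) = 1 := by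
    linear_combination -(b 0 1 3 * b' 0 0 2 + b 1 1 3 * b' 1 0 2) * x3 - y2 +
      (b 0 1 3 * b' 0 0 3 + b 1 1 3 * b' 1 0 3) * x2
  have hl : b 0 0 1 * (b' 0 0 3 * b' 1 0 2 - b' 0 0 2 * b' 1 0 3) = 0 := by
    linear_combination -(b' 1 0 2) * r13 + b' 1 0 3 * r12
  have hm : b 1 0 1 * (b' 0 0 3 * b' 1 0 2 - b' 0 0 2 * b' 1 0 3) = 0 := by
    linear_combination -(b' 0 0 3) * r12 + b' 0 0 2 * r13
  have hDne : b' 0 0 3 * b' 1 0 2 - b' 0 0 2 * b' 1 0 3 ≠ 0 := fun h0 => by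
    rw [h0, mul_zero] at hD; exact zero_ne_one hD
  have hl0 : b 0 0 1 = 0 := (mul_eq_zero.1 hl).resolve_right hDne
  have hm0 : b 1 0 1 = 0 := (mul_eq_zero.1 hm).resolve_right hDne
  rw [hl0, hm0] at q13
  norm_num at q13

/-- **BLOCK is impossible**: no two rows `c₀ ≠ d₀` of both `g_t` vanish (letter relabelling to `{0,1}`). -/
theorem block_false (g h b b' : Fin 2 → Fin 4 → Fin 4 → ℂ) (c c' : Fin 4 → Fin 4 → ℂ)
    (hsum : ∀ v, permPattern₄ v = (∑ t, g t (v 0) (v 1) * h t (v 2) (v 3)) +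
      (∑ k, b k (v 0) (v 2) * b' k (v 1) (v 3)) + c (v 0) (v 3) * c' (v 1) (v 2))
    (c₀ d₀ : Fin 4) (hcd : c₀ ≠ d₀) (hrows : ∀ t j, g t c₀ j = 0 ∧ g t d₀ j = 0) : False := by
  obtain ⟨π, h0, h1⟩ := exists_perm_zero_one c₀ d₀ hcd
  exact block01_false (fun t x y => g t (π x) (π y)) (fun t x y => h t (π x) (π y))
    (fun k x y => b k (π x) (π y)) (fun k x y => b' k (π x) (π y)) (fun x y => c (π x) (π y))
    (fun x y => c' (π x) (π y)) (hsum221_letterPerm g h b b' c c' hsum π)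
    (fun t j => by simp only [h0, h1]; exact ⟨(hrows t (π j)).1, (hrows t (π j)).2⟩)

end LaplaceFourLine

end Summit.ValiantsHypothesis.ValiantsHypothesis.Theorems.RigidityForcesSymmetryRankRigidMinimalRepr
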